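import Summits.BirchSwinnertonDyer.Rank1Residual.Additive.CyclotomicThreeSplitMultiplicativeReduction
import Summits.BirchSwinnertonDyer.Rank1Residual.Additive.TateDataUnramifiedTorsion
import HarnessLib

/-!
# Split multiplicative reduction persists at EVERY place above the prime, over any number field;
# the Tamagawa witness of the budget programme at the places of a layer `K' ⊇ ℚ`
# (cell `b2b-bsdres`, team n1011, seat p16 GEN 4; row T-BUD5-K FILE 6, lead R5-51 deal
# "Tate-data transfer ℚ_ℓ → (ℚ_n)_w for p10's `hwitn`", NO-TRANSFER form)

HONEST FRAMING (cell `b2b-bsdres`, run/shared/lean/b2b/bsd-rank1-residual/, verbatim in every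
file): the goal of the cell is to DELETE the COMBINATION-SHAPED residual classes of the
Birch–Swinnerton-Dyer formula for ALL analytic-rank `≤ 1` elliptic curves over `ℚ` — "full BSD
formula for every rank `≤ 1` curve in class `C`" assembled STRICTLY from published theorems — so
that the rank-`≤ 1` remainder becomes exactly the CONSTRUCTION-SHAPED classes, which are TYPED
(missing-input `Prop`s), NOT attempted. This is not "finishing BSD". Team n1011 (N10 / N11, the
Route-G budget node): research route; no claim beyond the stated classes; nothing is booked; marks
UNCHANGED. Theorems only: no definition, no named fact, no `sorry`.

## What and why

n1011-p10's level-`n` socket `exists_finset_layerZero_of_tamagawaWitnesses` is instantiated at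
`K' = κ.layer n` and wants, at every place `w ∣ ℓ` (`ℓ ≠ p` a Tamagawa prime of `V/ℚ`), the witness
`hwitn : ∃ u ∈ H¹_ur(K'_w, E[p]), u ∉ 𝓚_w`. This seat's
`exists_mem_unramifiedSubgroup_not_mem_kummerLocalConditionAt_of_tateUniformisation_of_torsion`
(`TateDataUnramifiedTorsion.lean`) gives it for ANY number field from: Tate's uniformisation (named
fact A40, applied over `K'` itself — no `q` is transported), SPLIT multiplicative reduction of
`V ⊗ K'` at `w`, `p ∉ w`, and unramified `p`-torsion at `w`. This file discharges the reduction-type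
input once and for all:

* `hasSplitMultiplicativeReductionAt_baseChange_of_hasSplitMultiplicativeReductionAtPrime` — **for
  `V/ℚ` globally minimal with SPLIT multiplicative reduction at `ℓ`, `K` ANY number field and `𝔭` ANY
  place of `K` above `ℓ`: `V ⊗ K` has split multiplicative reduction at `𝔭`** (no ramification or
  degree hypothesis: `V_ℤ ⊗ 𝒪_𝔭` is minimal with multiplicative reduction — additive-p2's
  `isMinimalAt_and_hasMultiplicativeReductionAt_baseChange_of_mult` — and its node-tangent quadratic
  is that of `V_ℤ mod ℓ`, split over `𝔽_ℓ`, mapped along `𝔽_ℓ → k_𝔭`; the general-`𝔭` form of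
  additive-p2's `hasSplitMultiplicativeReductionAt_baseChange_of_split`, which is `ℓ = 3`, `N(𝔭) = 3`).
* `exists_mem_unramifiedSubgroup_not_mem_kummerLocalConditionAt_baseChange_of_torsion` — **the
  level-`K` Tamagawa witness**: for `V/ℚ` globally minimal, split multiplicative at `ℓ ≠ p`, `K` any
  number field, `𝔭 ∣ ℓ`: granted A40, if the `p`-torsion of `V` over `K̄_𝔭` is unramified then
  `∃ u ∈ H¹_ur(K_𝔭, V[p])`, `u ∉ 𝓚_𝔭` — p10's `hwitn` with exactly TWO inputs left: the named fact A40
  and the unramifiedness of `V[p]` at `𝔭` ((L1), n1011-p14's deal: at a split multiplicative `𝔭 ∤ p`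
  it is `p ∣ ord_𝔭(Δ_min)`, Silverman *ATAEC* Ex. 5.13 (b); not proved in the tree).

References: Silverman *AEC* VII.5 Prop. 5.1 (b), VII.1 Prop. 1.3 (b), Remark VII.1.1; *ATAEC* V.3,
V.5, Ex. 5.13; Greenberg LNM 1716 p. 74.
-/

noncomputable section

open scoped Classical NumberField

open WeierstrassCurve NumberField IsDedekindDomain Rat.HeightOneSpectrum
  Literature.NumberTheory.EllipticCurves Literature.NumberTheory.EllipticCurves.Rank1Residual
  Literature.NumberTheory.GaloisRepresentations Field

namespace Summit.BirchSwinnertonDyer.Rank1Residual.Additive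

section Split

variable (V : WeierstrassCurve ℚ) [V.IsElliptic] [V.IsGloballyMinimal] (ℓ : ℕ) [hℓ : Fact ℓ.Prime]
variable {K : Type} [Field K] [NumberField K]

/-- **Split multiplicative reduction at `ℓ` persists at every place above `ℓ` of every number
field.** For `V/ℚ` globally minimal with split multiplicative reduction at `ℓ`, `K` a number field
and `𝔭` a place of `K` with `ℓ ∈ 𝔭`: `V ⊗ K` has split multiplicative reduction at `𝔭`. (`V_ℤ ⊗ 𝒪_𝔭`
is a minimal equation with multiplicative reduction — `c₄` is an `ℓ`-adic, hence `𝔭`-adic, unit —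
and its node-tangent quadratic is the one of `V_ℤ mod ℓ`, which splits over `𝔽_ℓ`, read in
`k_𝔭 ⊇ 𝔽_ℓ`.) [cite: SilvermanAEC2009, VII.5 Prop. 5.1(b) and VII.1 Prop. 1.3(b)] -/
theorem hasSplitMultiplicativeReductionAt_baseChange_of_hasSplitMultiplicativeReductionAtPrime
    (𝔭 : HeightOneSpectrum (𝓞 K)) (hℓ𝔭 : ((ℓ : ℕ) : 𝓞 K) ∈ 𝔭.asIdeal)
    (hsplit : V.HasSplitMultiplicativeReductionAtPrime ℓ) :
    (V.baseChange K).HasSplitMultiplicativeReductionAt 𝔭 := by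
  have hmult : V.HasMultiplicativeReductionAtPrime ℓ := hsplit.hasMultiplicativeReductionAtPrime
  set R := 𝔭.adicCompletionIntegers K with hR
  set X : WeierstrassCurve (𝔭.adicCompletion K) := (V.baseChange K).baseChange (𝔭.adicCompletion K)
    with hX
  obtain ⟨hminK, hmultK⟩ :=
    isMinimalAt_and_hasMultiplicativeReductionAt_baseChange_of_mult V (p := ℓ) hmult 𝔭 hℓ𝔭
  haveI hmin : X.IsMinimal R := hminK
  have hΔX : X.Δ ≠ 0 := by
    rw [hX, baseChange, map_Δ, baseChange, map_Δ]
    refine (map_ne_zero _).mpr ((map_ne_zero _).mpr V.isUnit_Δ.ne_zero)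
  obtain ⟨D, hD⟩ : ∃ D : VariableChange (𝔭.adicCompletion K),
      (V.baseChange K).localMinimalModel 𝔭 = D • X := ⟨_, rfl⟩
  have hmultX : X.HasMultiplicativeReduction R := by
    have h := hmultK
    unfold HasMultiplicativeReductionAt at h
    rw [hD, hasMultiplicativeReduction_iff_of_isMinimal_of_eq_smul R rfl hΔX] at h
    exact h
  -- the integral model of `X` is `V_ℤ ⊗ 𝒪_𝔭`
  have h2 : X.integralModel R = (integralModelInt V).map (Int.castRingHom R) := by
    refine integralModel_eq_of_baseChange_eq _ _ ?_
    rw [hX]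
    conv_rhs => rw [← map_integralModelInt V]
    rw [baseChange, baseChange, baseChange, map_map, map_map, map_map]
    exact congrArg (integralModelInt V).map (RingHom.ext_int _ _)
  -- the residue field `k_𝔭` has characteristic `ℓ`
  have hℓR : ((ℓ : ℕ) : R) ∈ IsLocalRing.maximalIdeal R := by
    rw [hR, LocalPoints.mem_maximalIdeal_iff 𝔭]
    simpa using LocalPoints.valuation_natCast_lt_one 𝔭 hℓ𝔭
  have hℓk : ((ℓ : ℕ) : IsLocalRing.ResidueField R) = 0 := by
    rw [← map_natCast (IsLocalRing.residue R), IsLocalRing.residue_eq_zero_iff]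
    exact hℓR
  haveI hchar : CharP (IsLocalRing.ResidueField R) ℓ :=
    (CharP.charP_iff_prime_eq_zero hℓ.out).mpr hℓk
  let e : ZMod ℓ →+* IsLocalRing.ResidueField R := ZMod.castHom (dvd_refl ℓ) _
  have hsℓ := splits_nodal_of_hasSplitMultiplicativeReductionAtPrime V ℓ hsplit
  have hring : (algebraMap R (IsLocalRing.ResidueField R)).comp (Int.castRingHom R) =
      e.comp (Int.castRingHom (ZMod ℓ)) :=
    RingHom.ext_int _ _
  haveI : (D • X).IsMinimal R := by rw [← hD]; exact instIsMinimalLocalMinimalModel 𝔭 (V.baseChange K)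
  unfold HasSplitMultiplicativeReductionAt
  rw [hD, hasSplitMultiplicativeReduction_iff_of_isMinimal_of_eq_smul R rfl hΔX,
    hasSplitMultiplicativeReduction_iff]
  refine ⟨hmultX, ?_⟩
  rw [h2, nodalTangents_map, Polynomial.map_map, hring, ← Polynomial.map_map, ← nodalTangents_map]
  exact hsℓ.map e

end Split

/-! ## The level-`K` Tamagawa witness -/

section Witness

variable (V : WeierstrassCurve ℚ) [V.IsElliptic] [V.IsGloballyMinimal] {ℓ p : ℕ}
  [hℓ : Fact ℓ.Prime] [hp : Fact p.Prime]
variable {K : Type} [Field K] [NumberField K]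

/-- **The Tamagawa witness at the places of a number field above a split multiplicative prime
`ℓ ≠ p` of `V/ℚ`, from unramified `p`-torsion — modulo Tate's uniformisation (A40).** For `V/ℚ`
globally minimal with split multiplicative reduction at `ℓ`, `K` ANY number field (e.g. a layer
`ℚ_n` of the cyclotomic `ℤ_p`-extension) and `𝔭 ∋ ℓ` a place of `K`: if every `p`-torsion point of
`V` over `K̄_𝔭` is fixed by the inertia group of `K_𝔭`, then
`∃ u ∈ H¹_ur(K_𝔭, V[p])`, `u ∉ 𝓚_𝔭` — n1011-p10's binder `hwitn`, literally, for `W = V ⊗ K`.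
CONDITIONAL on the named fact `Silverman1994_thmV53_tateUniformisation` (hypothesis `hU`); the other
binder `hI` is the unramifiedness of `V[p]` at `𝔭` ((L1): at a split multiplicative `𝔭 ∤ p` it is
`p ∣ ord_𝔭(Δ_min) = ord_ℓ(Δ_min(V))`, Silverman *ATAEC* Ex. 5.13 (b) — NOT proved in the tree).
[cite: SilvermanATAEC1994, Ch. V Thm. 3.1 (c),(d) and Thm. 5.3 (a),(b)]
[cite: GreenbergLNM1716, §3 p. 74 and Cor. 5.6 (proof)] -/
theorem exists_mem_unramifiedSubgroup_not_mem_kummerLocalConditionAt_baseChange_of_torsion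
    (hU : Silverman1994_thmV53_tateUniformisation.{0}) (hne : ℓ ≠ p)
    (hsplit : V.HasSplitMultiplicativeReductionAtPrime ℓ)
    (𝔭 : HeightOneSpectrum (𝓞 K)) (hℓ𝔭 : ((ℓ : ℕ) : 𝓞 K) ∈ 𝔭.asIdeal)
    (hI : ∀ Q : localPoints (V.baseChange K) (𝔭.adicCompletion K), (p : ℤ) • Q = 0 →
      ∀ τ ∈ absInertia (𝔭.adicCompletion K), τ • Q = Q) :
    ∃ u ∈ DiscreteGaloisModule.unramifiedSubgroup
        (((V.baseChange K).torsionGaloisModule (p : ℤ)).restrictField (𝔭.adicCompletion K)) 1,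
      u ∉ (V.baseChange K).kummerLocalConditionAt (p : ℤ) (𝔭.adicCompletion K) := by
  haveI : (V.baseChange K).IsElliptic := by rw [baseChange]; infer_instance
  exact (V.baseChange K).exists_mem_unramifiedSubgroup_not_mem_kummerLocalConditionAt_of_tateUniformisation_of_torsion
    𝔭 hU (hasSplitMultiplicativeReductionAt_baseChange_of_hasSplitMultiplicativeReductionAtPrime V ℓ 𝔭
      hℓ𝔭 hsplit) (HeightOneSpectrum.natCast_not_mem_asIdeal_of_prime_mem hℓ𝔭
        (fun h => hne ((Nat.prime_dvd_prime_iff_eq hℓ.out hp.out).mp h))) hI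

end Witness

end Summit.BirchSwinnertonDyer.Rank1Residual.Additive

/-! ## Erratum (seat n1011-p16 GEN 5, 2026-08-21; documentation only — no declaration above changes)

The sentences in this file that call (L1) — "at a (split) multiplicative place `v ∤ p` with
`p ∣ ord_v(Δ_min)` the inertia group acts trivially on `E[p]`" — "NOT proved in the tree" /
"not in the tree" / "n1011-p14's deal" are RETIRED. (L1) IS a tree theorem, and was when this file
landed: `WeierstrassCurve.smul_eq_of_mem_inertia_of_hasMultiplicativeReductionAt_of_dvd`
(`Literature/NumberTheory/EllipticCurves/MultiplicativeUnramifiedTorsionProofs.lean`, in the tree since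
2026-08-16; Kodaira–Néron over `K_v^nr`, no Tate curve; Serre, Invent. Math. 15 (1972) n° 1.12;
Silverman *ATAEC* Ex. 5.13 (b)), read on `absInertia K_v` through
`IsDedekindDomain.HeightOneSpectrum.inertia_eq_absInertia`
(`KodairaNeronUnramifiedInertiaProofs.lean`). The binder `hI` of `exists_mem_unramifiedSubgroup_not_mem_kummerLocalConditionAt_baseChange_of_torsion` is
thereby discharged from `p ∣ ord_v(Δ_min)`, i.e. from the census datum `p ∣ c_v` at a split
multiplicative place (`localTamagawaNumber_eq_ordMinimalDiscriminant_of_hasSplitMultiplicativeReductionAt`),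
modulo A40 only and with NO `μ_p ⊄ K_v` side condition, in n1011-p01's row T-L1-KN file
`Summits/BirchSwinnertonDyer/Rank1Residual/Additive/SplitMultiplicativeWitnessOfTamagawa.lean` (p276169):
`forall_absInertia_smul_eq_of_dvd_ordMinimalDiscriminant`,
`exists_mem_unramifiedSubgroup_not_mem_kummerLocalConditionAt_of_tateUniformisation_of_split_of_dvd_localTamagawaNumber`
(any number field `K`, any split multiplicative `v ∤ p`) and
`exists_mem_unramifiedSubgroup_not_mem_kummerLocalConditionAt_baseChange_of_split_of_dvd_localTamagawaNumber`
(`V/ℚ` globally minimal, any number field, any place above the Tamagawa prime). The cell's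
"(L1) residual scope" (lead R5-54) is EMPTY. -/

end
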